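import Summits.BirchSwinnertonDyer.BirchSwinnertonDyer.Statement
import Literature.NumberTheory.EllipticCurves.LeadingTerm
import Summits.BirchSwinnertonDyer.BirchSwinnertonDyer.Theorems.SoloBlindPAdicSqueeze

/-!
# SoloBlind — the cell decomposition of the BSD rank conjecture

For an elliptic curve `E/ℚ` write `a(E) = ord_{s=1} L(E,s)` (`WeierstrassCurve.analyticRank`) and
`r(E) = rank_ℤ E(ℚ)` (`WeierstrassCurve.mordellWeilRank`). The summit `BirchSwinnertonDyer` says the
pair `(a(E), r(E))` always lies on the diagonal of `ℕ × ℕ`.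

The one unconditional input used here is the Gross–Zagier–Kolyvagin theorem over `ℚ`
(named fact `Literature.NumberTheory.EllipticCurves.rank_eq_analyticRank_of_analyticRank_le_one`,
Gross–Zagier 1986 Thm. I.6.3 + Kolyvagin 1990 Thm. A + modularity; Darmon, CBMS 101, Thm. 3.22):
`a(E) ≤ 1 → r(E) = a(E)`. It excludes every off-diagonal cell in the two rows `a = 0`, `a = 1`.

This file records, kernel-checked, exactly what is then left of the summit:

* `analyticRank_ne_zero_of_mordellWeilRank_ne_zero` (and the tree's `r ≥ 2 → a ≥ 2`):
  the contrapositive uses of GZK (`r ≥ 2 → a ≥ 2`, `r ≥ 1 → a ≥ 1`): the columns `r = 0, 1` can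
  only fail BSD through cells with `a ≥ 2`, and `r ≤ a` is known whenever `r ≤ 2 ≤ a` or `a ≤ 1`.
* `bsd_iff_two_le_analyticRank`: `BSD ↔ ∀ E, 2 ≤ a(E) → a(E) = r(E)`.
* `bsd_iff_cells`: `BSD ↔ CellRankZero ∧ CellRankOne ∧ CellDeep`, the three genuinely open pieces:
  - `CellRankZero : r(E) = 0 → a(E) = 0` ("a finite Mordell–Weil group forces `L(E,1) ≠ 0`");
  - `CellRankOne  : r(E) = 1 → a(E) = 1` (the rank-one converse *without* a finiteness-of-`Ш`
    hypothesis);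
  - `CellDeep     : 2 ≤ r(E) → 2 ≤ a(E) → a(E) = r(E)` (both invariants at least two).
  By the `p`-converse theorems (Skinner–Urban; Skinner, Burungale–Skinner–Tian–Wan, Kim,
  Burungale–Tian) the first two cells are equivalent to finiteness of `Ш(E/ℚ)[p^∞]` for one
  admissible prime `p`, for curves of rank `0`, resp. `1`; nothing is known about `CellDeep` beyond
  parity. See the soloist's PLAN.md for the census.
* `bsd_iff_upper_and_lower`: the summit as the conjunction of the two inequalities, and
  `lowerBound_iff_of_gzk` / `upperBound_iff_of_gzk`: each inequality reduced to its `a ≥ 2` part.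

No new mathematics is claimed: this is the bookkeeping that pins the open core to named cells.
-/

noncomputable section

open scoped Classical

open WeierstrassCurve Literature.NumberTheory.EllipticCurves

set_option linter.dupNamespace false

namespace Summit.BirchSwinnertonDyer.BirchSwinnertonDyer.Theorems.SoloBlind

/-- Cell `r = 0`: a finite Mordell–Weil group forces analytic rank `0` (i.e. `L(E,1) ≠ 0`). Open (a cell of the BSD rank conjecture). [cite: Wiles2000] -/
@[conjecture] def CellRankZero : Prop :=
  ∀ W : WeierstrassCurve ℚ, W.IsElliptic → W.mordellWeilRank = 0 → W.analyticRank = 0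

/-- Cell `r = 1`: Mordell–Weil rank one forces analytic rank one, with no hypothesis on `Ш`. Open (a cell of the BSD rank conjecture). [cite: Wiles2000] -/
@[conjecture] def CellRankOne : Prop :=
  ∀ W : WeierstrassCurve ℚ, W.IsElliptic → W.mordellWeilRank = 1 → W.analyticRank = 1

/-- The deep cells: both the Mordell–Weil rank and the analytic rank are at least two. Open, and
untouched by every known method (no construction of two independent points from second-order
vanishing; no transfer of order of vanishing `≥ 2` between `L(E,s)` and any algebraic invariant). [cite: Wiles2000] -/
@[conjecture] def CellDeep : Prop :=
  ∀ W : WeierstrassCurve ℚ, W.IsElliptic → 2 ≤ W.mordellWeilRank → 2 ≤ W.analyticRank →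
    W.analyticRank = W.mordellWeilRank

/-- The upper-bound half of BSD: `rank ≤ ord`. [cite: Wiles2000] -/
@[conjecture] def UpperBound : Prop :=
  ∀ W : WeierstrassCurve ℚ, W.IsElliptic → W.mordellWeilRank ≤ W.analyticRank

/-- The lower-bound half of BSD: `ord ≤ rank` ("enough rational points"). [cite: Wiles2000] -/
@[conjecture] def LowerBound : Prop :=
  ∀ W : WeierstrassCurve ℚ, W.IsElliptic → W.analyticRank ≤ W.mordellWeilRank

/-- The `a ≥ 2` part of the upper bound: `2 ≤ a(E) → r(E) ≤ a(E)`. [cite: Wiles2000] -/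
@[conjecture] def UpperBoundHigh : Prop :=
  ∀ W : WeierstrassCurve ℚ, W.IsElliptic → 2 ≤ W.analyticRank → W.mordellWeilRank ≤ W.analyticRank

/-- The `a ≥ 2` part of the lower bound: `2 ≤ a(E) → a(E) ≤ r(E)` — in particular it contains the
famous open implication "`ord_{s=1} L(E,s) ≥ 2 ⇒ E(ℚ)` is infinite". [cite: Wiles2000] -/
@[conjecture] def LowerBoundHigh : Prop :=
  ∀ W : WeierstrassCurve ℚ, W.IsElliptic → 2 ≤ W.analyticRank → W.analyticRank ≤ W.mordellWeilRank

section GZKConsequences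

-- GZK unpacked (`a ≤ 1 → r = a`) is the landed `rank_eq_of_le_one` of
-- `Theorems/SoloBlindPAdicSqueeze.lean` (p174396), used below by name.

-- `r(E) ≥ 2 → a(E) ≥ 2` (contrapositive of GZK) is already a landed tree theorem (gate dedup
-- against Theorems/SoloInformedFirstInstances); it is not restated here.

/-- Contrapositive of the rank-zero part of GZK (equivalently of Kato's finiteness theorem):
`r(E) ≠ 0 → a(E) ≠ 0`, i.e. a rational point of infinite order forces `L(E,1) = 0`. -/
theorem analyticRank_ne_zero_of_mordellWeilRank_ne_zero
    (hGZK : rank_eq_analyticRank_of_analyticRank_le_one)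
    (W : WeierstrassCurve ℚ) [W.IsElliptic]
    (h : W.mordellWeilRank ≠ 0) : W.analyticRank ≠ 0 := by
  intro h0
  have := rank_eq_of_le_one hGZK W (by omega)
  omega

/-- `r(E) = 1 → a(E) = 1 ∨ 2 ≤ a(E)`: the only way `CellRankOne` can fail is through a cell with
`a ≥ 2`. -/
theorem analyticRank_eq_one_or_two_le_of_mordellWeilRank_eq_one
    (hGZK : rank_eq_analyticRank_of_analyticRank_le_one)
    (W : WeierstrassCurve ℚ)
    [W.IsElliptic] (h : W.mordellWeilRank = 1) : W.analyticRank = 1 ∨ 2 ≤ W.analyticRank := by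
  have h0 := analyticRank_ne_zero_of_mordellWeilRank_ne_zero hGZK W (by omega)
  omega

/-- `r(E) = 0 → a(E) = 0 ∨ 2 ≤ a(E)`: the cell `(a, r) = (1, 0)` is excluded by GZK. -/
theorem analyticRank_eq_zero_or_two_le_of_mordellWeilRank_eq_zero
    (hGZK : rank_eq_analyticRank_of_analyticRank_le_one)
    (W : WeierstrassCurve ℚ)
    [W.IsElliptic] (h : W.mordellWeilRank = 0) : W.analyticRank = 0 ∨ 2 ≤ W.analyticRank := by
  by_cases h1 : W.analyticRank = 1
  · have := rank_eq_of_le_one hGZK W (by omega)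
    omega
  · omega

/-- **The summit is its `a ≥ 2` part.** Given GZK,
`BSD ↔ ∀ E, 2 ≤ ord_{s=1} L(E,s) → ord_{s=1} L(E,s) = rank E(ℚ)`. -/
theorem bsd_iff_two_le_analyticRank (hGZK : rank_eq_analyticRank_of_analyticRank_le_one) :
    _root_.BirchSwinnertonDyer ↔
      ∀ W : WeierstrassCurve ℚ, W.IsElliptic → 2 ≤ W.analyticRank →
        W.analyticRank = W.mordellWeilRank := by
  constructor
  · intro h W hE _
    exact h W hE
  · intro h W hE
    by_cases h2 : 2 ≤ W.analyticRank
    · exact h W hE h2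
    · haveI := hE
      exact (rank_eq_of_le_one hGZK W (by omega)).symm

/-- **Cell decomposition.** Given GZK, the summit is exactly the conjunction of the three open
cells `CellRankZero`, `CellRankOne`, `CellDeep`. -/
theorem bsd_iff_cells (hGZK : rank_eq_analyticRank_of_analyticRank_le_one) :
    _root_.BirchSwinnertonDyer ↔ CellRankZero ∧ CellRankOne ∧ CellDeep := by
  constructor
  · intro h
    refine ⟨fun W hE h0 => ?_, fun W hE h1 => ?_, fun W hE _ _ => h W hE⟩
    · have := h W hE; omega
    · have := h W hE; omega
  · rintro ⟨h0, h1, hd⟩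
    rw [bsd_iff_two_le_analyticRank hGZK]
    intro W hE h2
    haveI := hE
    by_cases hr0 : W.mordellWeilRank = 0
    · have := h0 W hE hr0; omega
    by_cases hr1 : W.mordellWeilRank = 1
    · have := h1 W hE hr1; omega
    exact hd W hE (by omega) h2

/-- Given GZK, the lower bound `ord ≤ rank` is its `a ≥ 2` part. -/
theorem lowerBound_iff_of_gzk
    (hGZK : rank_eq_analyticRank_of_analyticRank_le_one) : LowerBound ↔ LowerBoundHigh := by
  constructor
  · intro h W hE _; exact h W hE
  · intro h W hE
    by_cases h2 : 2 ≤ W.analyticRank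
    · exact h W hE h2
    · haveI := hE
      exact (rank_eq_of_le_one hGZK W (by omega)).symm.le

/-- Given GZK, the upper bound `rank ≤ ord` is its `a ≥ 2` part; and there it is automatic for
`rank ≤ 2`, so its content is `2 ≤ a(E) → 3 ≤ r(E) → r(E) ≤ a(E)`. -/
theorem upperBound_iff_of_gzk (hGZK : rank_eq_analyticRank_of_analyticRank_le_one) :
    UpperBound ↔
      ∀ W : WeierstrassCurve ℚ, W.IsElliptic → 2 ≤ W.analyticRank → 3 ≤ W.mordellWeilRank →
        W.mordellWeilRank ≤ W.analyticRank := by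
  constructor
  · intro h W hE _ _; exact h W hE
  · intro h W hE
    haveI := hE
    by_cases h2 : 2 ≤ W.analyticRank
    · by_cases h3 : 3 ≤ W.mordellWeilRank
      · exact h W hE h2 h3
      · omega
    · exact (rank_eq_of_le_one hGZK W (by omega)).le

/-- `CellRankZero` and `CellRankOne` together are exactly the lower bound on the columns `r ≤ 1`;
with GZK, `CellRankZero ∧ CellRankOne ↔ ∀ E, r(E) ≤ 1 → a(E) = r(E)`. -/
theorem cellRankZero_and_cellRankOne_iff :
    CellRankZero ∧ CellRankOne ↔
      ∀ W : WeierstrassCurve ℚ, W.IsElliptic → W.mordellWeilRank ≤ 1 →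
        W.analyticRank = W.mordellWeilRank := by
  constructor
  · rintro ⟨h0, h1⟩ W hE hr
    by_cases hr0 : W.mordellWeilRank = 0
    · rw [hr0, h0 W hE hr0]
    · have hr1 : W.mordellWeilRank = 1 := by omega
      rw [hr1, h1 W hE hr1]
  · intro h
    exact ⟨fun W hE h0 => by have := h W hE (by omega); omega,
      fun W hE h1 => by have := h W hE (by omega); omega⟩

end GZKConsequences

/-- Unconditionally (no GZK needed): the summit is the conjunction of its two inequalities. -/
theorem bsd_iff_upper_and_lower : _root_.BirchSwinnertonDyer ↔ UpperBound ∧ LowerBound := by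
  constructor
  · intro h
    exact ⟨fun W hE => (h W hE).symm.le, fun W hE => (h W hE).le⟩
  · rintro ⟨hu, hl⟩ W hE
    exact le_antisymm (hl W hE) (hu W hE)

end Summit.BirchSwinnertonDyer.BirchSwinnertonDyer.Theorems.SoloBlind

end
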